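import Mathlib
import HarnessLib

/-!
# Ratio-floor superadditivity of the Einstein–Helfand heat variance
(crux `CageBudgetFekete.QuasiSuperadditiveHeatVariance`, item stmt-AtomisticToContinuum-15769; `--supports` file,
closes nothing)

WHAT. The real-analysis stub `stub_ratioFloorSuperadditive` of the crux's tree skeleton
`Cruxes/QuasiSuperadditiveHeatVariance/Lines/ratio_floor.lean` (verbatim signature): for every continuous memory
`C : ℝ → ℝ`, the heat variance `V(τ) = 2∫_{(0,τ]} (τ - s) C(s) ds` and every `K'` with
`-K' ≤ ∫_{(0,τ]} s C(s) ds` for all `τ ≥ 0` (a FLOOR for the running first moment of the memory), one has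
`V s + V t ≤ V (s + t) + 2 K'` for all `s, t ≥ 0` — a floor for the running first moment is a cage budget.  It is
the glue `F → Q` from the weakest known time-domain sufficient condition F (first-moment floor) to the crux Q.

HOW. Star-shapedness with defect (Bruckner–Ostrow): with the primitives `F = ∫₀ C`, `G = ∫₀ x C(x) dx` one has
`V = 2(τF - G)` on `[0,∞)`, and `ψ(v) := V(v)/v - 2K'/v = 2F(v) - (2G(v) + 2K')/v` has derivative
`2(G(v) + K')/v² ≥ 0` on `(0,∞)`, hence is monotone there (`monotoneOn_of_deriv_nonneg`).  Monotonicity between `s`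
and `s + t` (and between `t` and `s + t`), cleared of denominators, gives `(s+t)·V s ≤ s·V(s+t) + 2K' t` and the
symmetric bound; adding them and dividing by `s + t` proves the claim.  The degenerate cases `s = 0` / `t = 0` use
`V 0 = 0` and `0 ≤ K'` (the floor at `τ = 0`).

NOT here: the physical half (a floor for the running first moment of the chain's summed-current memory).
-/

noncomputable section

namespace Summit.AtomisticToContinuum.FouriersLaw.Theorems.QuasiSuperadditiveHeatVariance.RatioFloor

open MeasureTheory Filter Set intervalIntegral
open scoped Topology

/-- Closed form of the heat variance on `[0, ∞)`: `2∫_{(0,τ]} (τ - x) C(x) dx = 2(τ ∫₀^τ C - ∫₀^τ x C(x) dx)`.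
[folklore] -/
theorem heatVariance_closed_form {C : ℝ → ℝ} (hC : Continuous C) {τ : ℝ} (hτ : 0 ≤ τ) :
    2 * ∫ x in Set.Ioc (0:ℝ) τ, (τ - x) * C x =
      2 * (τ * (∫ x in (0:ℝ)..τ, C x) - ∫ x in (0:ℝ)..τ, x * C x) := by
  have hxC : Continuous fun x : ℝ => x * C x := continuous_id.mul hC
  congr 1
  rw [← intervalIntegral.integral_of_le hτ]
  have e : (fun x : ℝ => (τ - x) * C x) = fun x : ℝ => τ * C x - x * C x := funext fun x => by ring
  rw [e, intervalIntegral.integral_sub ((hC.const_mul τ).intervalIntegrable _ _)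
    (hxC.intervalIntegrable _ _), intervalIntegral.integral_const_mul]

/-- **Star-shapedness with defect.** For continuous `C`, primitives `F = ∫₀ C`, `G = ∫₀ x C(x) dx` and a floor
`-K' ≤ G` on `[0, ∞)`, the function `v ↦ 2 F v - (2 G v + 2 K') / v` is monotone on `(0, ∞)` (its derivative is
`2 (G v + K') / v² ≥ 0`). [folklore] -/
theorem monotoneOn_ratio {C : ℝ → ℝ} (hC : Continuous C) {K' : ℝ}
    (hfloor : ∀ τ : ℝ, 0 ≤ τ → -K' ≤ ∫ x in (0:ℝ)..τ, x * C x) :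
    MonotoneOn (fun v : ℝ => 2 * (∫ x in (0:ℝ)..v, C x) -
      (2 * (∫ x in (0:ℝ)..v, x * C x) + 2 * K') / v) (Set.Ioi 0) := by
  set F : ℝ → ℝ := fun v => ∫ x in (0:ℝ)..v, C x
  set G : ℝ → ℝ := fun v => ∫ x in (0:ℝ)..v, x * C x
  have hxC : Continuous fun x : ℝ => x * C x := continuous_id.mul hC
  have hFd : ∀ v : ℝ, HasDerivAt F (C v) v := fun v => (hC.integral_hasStrictDerivAt 0 v).hasDerivAt
  have hGd : ∀ v : ℝ, HasDerivAt G (v * C v) v := fun v => (hxC.integral_hasStrictDerivAt 0 v).hasDerivAt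
  -- derivative of `ψ v = 2 F v - (2 G v + 2 K') / v` at `v ≠ 0`
  have hψd : ∀ v : ℝ, v ≠ 0 →
      HasDerivAt (fun v : ℝ => 2 * F v - (2 * G v + 2 * K') / v) (2 * (G v + K') / v ^ 2) v := by
    intro v hv
    have h1 : HasDerivAt (fun v : ℝ => 2 * F v) (2 * C v) v := (hFd v).const_mul 2
    have h2 : HasDerivAt (fun v : ℝ => 2 * G v + 2 * K') (2 * (v * C v)) v :=
      ((hGd v).const_mul 2).add_const (2 * K')
    have h3 : HasDerivAt (fun v : ℝ => (2 * G v + 2 * K') / v)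
        ((2 * (v * C v) * v - (2 * G v + 2 * K') * 1) / v ^ 2) v := h2.div (hasDerivAt_id' v) hv
    refine (h1.sub h3).congr_deriv ?_
    field_simp
    ring
  refine monotoneOn_of_deriv_nonneg (convex_Ioi 0) ?_ ?_ ?_
  · intro v hv
    exact ((hψd v (ne_of_gt hv)).continuousAt).continuousWithinAt
  · rw [interior_Ioi]
    intro v hv
    exact ((hψd v (ne_of_gt hv)).differentiableAt).differentiableWithinAt
  · rw [interior_Ioi]
    intro v hv
    rw [(hψd v (ne_of_gt hv)).deriv]
    have hGv : -K' ≤ G v := hfloor v (le_of_lt hv)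
    have hnum : 0 ≤ 2 * (G v + K') := by linarith
    exact div_nonneg hnum (sq_nonneg v)

/-- One-sided consequence of the monotone ratio, cleared of denominators: for `0 < s ≤ u`,
`u · V(s) ≤ s · V(u) + 2 K' (u - s)`, written with the closed form `V = 2(τ F - G)`. [folklore] -/
theorem scaled_le_of_floor {C : ℝ → ℝ} (hC : Continuous C) {K' : ℝ}
    (hfloor : ∀ τ : ℝ, 0 ≤ τ → -K' ≤ ∫ x in (0:ℝ)..τ, x * C x) {s u : ℝ} (hs : 0 < s) (hsu : s ≤ u) :
    u * (2 * (s * (∫ x in (0:ℝ)..s, C x) - ∫ x in (0:ℝ)..s, x * C x)) ≤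
      s * (2 * (u * (∫ x in (0:ℝ)..u, C x) - ∫ x in (0:ℝ)..u, x * C x)) + 2 * K' * (u - s) := by
  have hu : 0 < u := lt_of_lt_of_le hs hsu
  have hs' : s ≠ 0 := ne_of_gt hs
  have hu' : u ≠ 0 := ne_of_gt hu
  have hmono : 2 * (∫ x in (0:ℝ)..s, C x) - (2 * (∫ x in (0:ℝ)..s, x * C x) + 2 * K') / s ≤
      2 * (∫ x in (0:ℝ)..u, C x) - (2 * (∫ x in (0:ℝ)..u, x * C x) + 2 * K') / u :=
    monotoneOn_ratio hC hfloor (Set.mem_Ioi.2 hs) (Set.mem_Ioi.2 hu) hsu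
  have key := mul_le_mul_of_nonneg_right hmono (le_of_lt (mul_pos hs hu))
  have e1 : (2 * (∫ x in (0:ℝ)..s, C x) - (2 * (∫ x in (0:ℝ)..s, x * C x) + 2 * K') / s) * (s * u) =
      u * (2 * (s * (∫ x in (0:ℝ)..s, C x) - ∫ x in (0:ℝ)..s, x * C x)) - 2 * K' * u := by
    field_simp
    ring
  have e2 : (2 * (∫ x in (0:ℝ)..u, C x) - (2 * (∫ x in (0:ℝ)..u, x * C x) + 2 * K') / u) * (s * u) =
      s * (2 * (u * (∫ x in (0:ℝ)..u, C x) - ∫ x in (0:ℝ)..u, x * C x)) - 2 * K' * s := by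
    field_simp
    ring
  rw [e1, e2] at key
  linarith

/-- **Stub `stub_ratioFloorSuperadditive` (registered signature of line `ratio-floor`, verbatim): a floor for the
running first moment of the memory is a cage budget.** For continuous `C`, `V(τ) = 2∫_{(0,τ]} (τ - s) C(s) ds` and
`K'` with `-K' ≤ ∫_{(0,τ]} s C(s) ds` for all `τ ≥ 0`: `V s + V t ≤ V (s + t) + 2 K'` for all `s, t ≥ 0`.
[folklore] -/
theorem stub_ratioFloorSuperadditive :
    ∀ C : ℝ → ℝ, Continuous C → ∀ V : ℝ → ℝ,
      V = (fun τ : ℝ => 2 * ∫ s in Set.Ioc (0:ℝ) τ, (τ - s) * C s) →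
    ∀ K' : ℝ, (∀ τ : ℝ, 0 ≤ τ → -K' ≤ ∫ s in Set.Ioc (0:ℝ) τ, s * C s) →
    ∀ s t : ℝ, 0 ≤ s → 0 ≤ t → V s + V t ≤ V (s + t) + 2 * K' := by
  intro C hC V hV K' hfloor s t hs ht
  -- the floor in interval-integral form
  have hfloor' : ∀ τ : ℝ, 0 ≤ τ → -K' ≤ ∫ x in (0:ℝ)..τ, x * C x := fun τ hτ => by
    rw [intervalIntegral.integral_of_le hτ]; exact hfloor τ hτ
  have hK' : 0 ≤ K' := by
    have h0 := hfloor' 0 le_rfl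
    rw [intervalIntegral.integral_same] at h0
    linarith
  -- closed form of `V` on `[0, ∞)`
  have hVc : ∀ τ : ℝ, 0 ≤ τ →
      V τ = 2 * (τ * (∫ x in (0:ℝ)..τ, C x) - ∫ x in (0:ℝ)..τ, x * C x) := fun τ hτ => by
    rw [congrFun hV τ]; exact heatVariance_closed_form hC hτ
  have hV0 : V 0 = 0 := by rw [hVc 0 le_rfl]; simp
  -- degenerate windows
  rcases eq_or_lt_of_le hs with hs0 | hs0
  · rw [← hs0, hV0, zero_add, zero_add]; linarith
  rcases eq_or_lt_of_le ht with ht0 | ht0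
  · rw [← ht0, hV0, add_zero, add_zero]; linarith
  -- generic windows: two scaled inequalities, added, divided by `s + t`
  have hst : 0 < s + t := add_pos hs0 ht0
  have h1 := scaled_le_of_floor hC hfloor' hs0 (le_add_of_nonneg_right ht)
  have h2 := scaled_le_of_floor hC hfloor' ht0 (le_add_of_nonneg_left hs)
  rw [← hVc s hs, ← hVc (s + t) hst.le] at h1
  rw [← hVc t ht, ← hVc (s + t) hst.le] at h2
  have hsum : (s + t) * (V s + V t) ≤ (s + t) * (V (s + t) + 2 * K') := by linarith
  exact le_of_mul_le_mul_left hsum hst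

end Summit.AtomisticToContinuum.FouriersLaw.Theorems.QuasiSuperadditiveHeatVariance.RatioFloor

end
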